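import Summits.NavierStokesRegularity.OSWSelfSimilar.SheetNSLineTorusCascadeExistence
import HarnessLib

/-!
# Viscous CLM on the torus (`a = 0`, `σ = 2`): the first two modes of the explicit cascade IN CLOSED FORM, by name

HONEST FRAMING (cell ns-blowup GROUP B «PROFILE SEARCH», zone Z3, row Z3-U addendum A-F2 of `HOME/profile/z3/CENSUS-Z3.md`,
pen gap (g2); human rulings D-0035/D-0074; profile-refuter g6 T-TICK on p507796, nits (c1)/(c2), 2026-08-27): **1-D MODEL
(viscous Constantin–Lax–Majda equation `ω_t = ω Hω + ν ω_xx` on `𝕋 = ℝ/2πℤ`); ODE calculus on the explicit Fourier-coefficient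
family `cascadeSolution ν a` of `SheetNSLineTorusCascadeExistence`; kernel-checked; not Euler, not Navier–Stokes; «violates:
none — MODEL».**

OBJECT. `SheetNSLineTorusCascadeExistence` constructs the global solution `cascadeSolution ν a k t` of the lower-triangular cascade
`ċ_k = ½ Σ_{i+j=k} c_i c_j − ν k² c_k`, `c_k(0) = a_k`, by strong recursion (Duhamel over the modes `< k`), and proves that every
`IsSineCascade ν c e` / `IsNonnegCascade ν e` of the family IS that object on `[0, ∞)`. The recursion is explicit enough to be
EVALUATED BY NAME, which is what a numerical table of the first modes has to be read against (eng-5's TWIN table, kit j269975,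
`modes["1"]`, `modes["2"]`):

* `truncConv_one` — mode `1` is never forced (the antidiagonal of `1` is `{(0,1), (1,0)}`; no pair has both entries `< 1`), hence
  `cascadeSolution_one : c_1(t) = e^{−νt} a_1` for EVERY datum and every real `t`; `cascadeSolution_sine_one : c_1(t) = c e^{−νt}`;
* `truncConv_two = c_1²` — mode `2` is forced by the single pair `(1,1)`, hence for `ν ≠ 0`
  `cascadeSolution_two : c_2(t) = e^{−4νt} a_2 + a_1² (e^{−2νt} − e^{−4νt})/(4ν)` and
  `cascadeSolution_sine_two : c_2(t) = c² (e^{−2νt} − e^{−4νt})/(4ν)`; the inviscid MODEL value `ν = 0`: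
  `cascadeSolution_sine_two_of_nu_zero : c_2(t) = c² t/2`;
* by uniqueness (`IsSineCascade.eq_cascadeSolution`) the same closed forms hold for ANY sine cascade on `[0, ∞)`:
  `IsSineCascade.mode_one_eq`, `IsSineCascade.mode_two_eq`;
* `sineDatum_two`, `sineDatum_of_ne_one` — `simp` unfoldings of the sine datum (T-tick (c2)).

bears_on: LADDER-NS N5 / zone Z3 (row Z3-U, A-F2 (g2)) → N1 linear core. WHAT THIS IS NOT: not NS; no PDE object; nothing about
the threshold value `c*/ν`; elementary calculus on two explicit functions.
-/

noncomputable section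

namespace Summit.NavierStokesRegularity.OSWSelfSimilar
namespace SheetNSLineTorusCascade

open Finset Real Set MeasureTheory intervalIntegral

variable {ν c : ℝ} {a : ℕ → ℝ}

/-! ### The sine datum, unfolded -/

/-- The sine datum has no mode `2`. -/
@[simp] theorem sineDatum_two (c : ℝ) : sineDatum c 2 = 0 := sineDatum_of_two_le c le_rfl

/-- The sine datum vanishes off mode `1` (simp unfolding, T-tick (c2)). -/
@[simp] theorem sineDatum_of_ne_one (c : ℝ) {k : ℕ} (hk : k ≠ 1) : sineDatum c k = 0 := by
  simp [sineDatum, hk]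

/-- Mode `0` of the sine cascade vanishes identically. -/
@[simp] theorem cascadeSolution_sine_zero (ν c t : ℝ) : cascadeSolution ν (sineDatum c) 0 t = 0 :=
  cascadeSolution_mode_zero (sineDatum_zero c) t

/-! ### Mode `1` -/

/-- **Mode `1` is never forced:** the truncated convolution driving mode `1` vanishes identically (the antidiagonal of `1` is
`{(0,1), (1,0)}`, and no pair has both entries `< 1`) — for every datum, with no hypothesis on `a 0`. [new here — MODEL] -/
theorem truncConv_one (ν : ℝ) (a : ℕ → ℝ) (s : ℝ) : truncConv ν a 1 s = 0 := by
  unfold truncConv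
  refine sum_eq_zero fun p hp => ?_
  have hsum : p.1 + p.2 = 1 := mem_antidiagonal.mp hp
  have hnot : ¬(p.1 < 1 ∧ p.2 < 1) := by omega
  rw [if_neg hnot]

/-- **Mode `1` in closed form, every datum:** `c_1(t) = e^{−νt} a_1` for every real `t`. [new here — MODEL] -/
theorem cascadeSolution_one (ν : ℝ) (a : ℕ → ℝ) (t : ℝ) :
    cascadeSolution ν a 1 t = exp (-(ν * t)) * a 1 := by
  rw [cascadeSolution_eq]
  simp [truncConv_one]

/-- **Mode `1` of the sine cascade:** `c_1(t) = c e^{−νt}` for every real `t` (T-tick (c1)). [new here — MODEL] -/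
theorem cascadeSolution_sine_one (ν c t : ℝ) : cascadeSolution ν (sineDatum c) 1 t = c * exp (-(ν * t)) := by
  rw [cascadeSolution_one, sineDatum_one, mul_comm]

/-! ### Mode `2` -/

/-- **Mode `2` is forced by `c_1²` only:** the truncated convolution driving mode `2` is `c_1(s)²` (of the antidiagonal
`{(0,2), (1,1), (2,0)}` only `(1,1)` has both entries `< 2`) — every datum, no hypothesis on `a 0`. [new here — MODEL] -/
theorem truncConv_two (ν : ℝ) (a : ℕ → ℝ) (s : ℝ) : truncConv ν a 2 s = cascadeSolution ν a 1 s ^ 2 := by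
  unfold truncConv
  rw [Finset.Nat.sum_antidiagonal_eq_sum_range_succ_mk]
  simp [sum_range_succ]
  ring

/-- `∫₀ᵗ e^{λ s} ds = (e^{λ t} − 1)/λ` for `λ ≠ 0`. [folklore] -/
private theorem integral_exp_mul_zero_left {lam : ℝ} (hlam : lam ≠ 0) (t : ℝ) :
    ∫ s in (0 : ℝ)..t, exp (lam * s) = (exp (lam * t) - 1) / lam := by
  have h : ∀ x ∈ uIcc 0 t, HasDerivAt (fun s => exp (lam * s) / lam) (exp (lam * x)) x := by
    intro x _
    have h1 : HasDerivAt (fun s => lam * s) lam x := by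
      simpa using (hasDerivAt_id x).const_mul lam
    have h2 : HasDerivAt (fun s => exp (lam * s)) (exp (lam * x) * lam) x := (Real.hasDerivAt_exp _).comp x h1
    have h3 := h2.div_const lam
    rwa [mul_div_cancel_right₀ _ hlam] at h3
  have hint : IntervalIntegrable (fun s => exp (lam * s)) volume 0 t :=
    (by fun_prop : Continuous fun s => exp (lam * s)).intervalIntegrable _ _
  rw [integral_eq_sub_of_hasDerivAt h hint]
  simp [sub_div]

/-- **Mode `2` in closed form, every datum, `ν ≠ 0`:** `c_2(t) = e^{−4νt} a_2 + a_1² (e^{−2νt} − e^{−4νt})/(4ν)` for every real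
`t` (Duhamel over the single forcing pair `(1,1)` and `∫₀ᵗ e^{4νs} e^{−2νs} ds = (e^{2νt} − 1)/(2ν)`). [new here — MODEL] -/
theorem cascadeSolution_two {ν : ℝ} (hν : ν ≠ 0) (a : ℕ → ℝ) (t : ℝ) :
    cascadeSolution ν a 2 t =
      exp (-(4 * ν * t)) * a 2 + a 1 ^ 2 * (exp (-(2 * ν * t)) - exp (-(4 * ν * t))) / (4 * ν) := by
  rw [cascadeSolution_eq]
  have hint : ∀ s : ℝ, exp (ν * ((2 : ℕ) : ℝ) ^ 2 * s) * truncConv ν a 2 s = a 1 ^ 2 * exp (2 * ν * s) := by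
    intro s
    rw [truncConv_two, cascadeSolution_one]
    have : exp (ν * ((2 : ℕ) : ℝ) ^ 2 * s) * (exp (-(ν * s))) ^ 2 = exp (2 * ν * s) := by
      rw [← exp_nat_mul, ← exp_add]
      congr 1
      push_cast
      ring
    calc exp (ν * ((2 : ℕ) : ℝ) ^ 2 * s) * (exp (-(ν * s)) * a 1) ^ 2
        = (exp (ν * ((2 : ℕ) : ℝ) ^ 2 * s) * (exp (-(ν * s))) ^ 2) * a 1 ^ 2 := by ring
      _ = a 1 ^ 2 * exp (2 * ν * s) := by rw [this, mul_comm]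
  have h2ν : (2 * ν) ≠ 0 := mul_ne_zero two_ne_zero hν
  have hI : ∫ s in (0 : ℝ)..t, exp (ν * ((2 : ℕ) : ℝ) ^ 2 * s) * truncConv ν a 2 s
      = a 1 ^ 2 * ((exp (2 * ν * t) - 1) / (2 * ν)) := by
    rw [intervalIntegral.integral_congr (fun s _ => hint s), intervalIntegral.integral_const_mul,
      integral_exp_mul_zero_left h2ν]
  rw [hI]
  have h4 : exp (-(ν * ((2 : ℕ) : ℝ) ^ 2 * t)) = exp (-(4 * ν * t)) := by
    congr 1; push_cast; ring
  rw [h4]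
  have hprod : exp (-(4 * ν * t)) * exp (2 * ν * t) = exp (-(2 * ν * t)) := by
    rw [← exp_add]; congr 1; ring
  rw [← hprod]
  field_simp
  ring

/-- **Mode `2` of the sine cascade, `ν ≠ 0`:** `c_2(t) = c² (e^{−2νt} − e^{−4νt})/(4ν)` for every real `t` (T-tick (c1)).
[new here — MODEL] -/
theorem cascadeSolution_sine_two {ν : ℝ} (hν : ν ≠ 0) (c t : ℝ) :
    cascadeSolution ν (sineDatum c) 2 t = c ^ 2 * (exp (-(2 * ν * t)) - exp (-(4 * ν * t))) / (4 * ν) := by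
  rw [cascadeSolution_two hν, sineDatum_one, sineDatum_two, mul_zero, zero_add]

/-- **Mode `2` of the sine cascade in the inviscid MODEL value `ν = 0`:** `c_2(t) = c² t/2`. [new here — MODEL] -/
theorem cascadeSolution_sine_two_of_nu_zero (c t : ℝ) :
    cascadeSolution 0 (sineDatum c) 2 t = c ^ 2 * t / 2 := by
  rw [cascadeSolution_eq]
  have hint : ∀ s : ℝ, exp (0 * ((2 : ℕ) : ℝ) ^ 2 * s) * truncConv 0 (sineDatum c) 2 s = c ^ 2 := by
    intro s
    rw [truncConv_two, cascadeSolution_sine_one]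
    simp
  rw [intervalIntegral.integral_congr (fun s _ => hint s), intervalIntegral.integral_const]
  simp
  ring

/-! ### The same for ANY sine cascade (uniqueness transfers the closed forms) -/

/-- **Every sine cascade has these first two modes** (uniqueness `IsSineCascade.eq_cascadeSolution` transfers the closed forms
to any `IsSineCascade ν c e` on `[0, ∞)`): mode `1` of ANY sine cascade is `e 1 t = c e^{−νt}`. [new here — MODEL] -/
theorem IsSineCascade.mode_one_eq {e : ℕ → ℝ → ℝ} (he : IsSineCascade ν c e) {t : ℝ} (ht : 0 ≤ t) :
    e 1 t = c * exp (-(ν * t)) := by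
  rw [he.eq_cascadeSolution 1 t ht, cascadeSolution_sine_one]

/-- Mode `2` of ANY sine cascade, `ν ≠ 0`, on `[0, ∞)`: `e 2 t = c²(e^{−2νt} − e^{−4νt})/(4ν)`. [new here — MODEL] -/
theorem IsSineCascade.mode_two_eq {e : ℕ → ℝ → ℝ} (he : IsSineCascade ν c e) (hν : ν ≠ 0) {t : ℝ} (ht : 0 ≤ t) :
    e 2 t = c ^ 2 * (exp (-(2 * ν * t)) - exp (-(4 * ν * t))) / (4 * ν) := by
  rw [he.eq_cascadeSolution 2 t ht, cascadeSolution_sine_two hν]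

end SheetNSLineTorusCascade
end Summit.NavierStokesRegularity.OSWSelfSimilar

end
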